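import Summits.Ventures.PercRepro.C025ProfilePriceMono

/-!
# THE SECOND ROW ON «A FAT FLAT PLUS FREE POINTS» — THE ARITHMETIC CORE (night-3 g24)

`proofs/NIGHT3-G24-ONEFLAT.md` §1–§2.  For a level profile `W : ℕ → ℕ` (think `W c = #{Y ⊆ E₁ : ρ₁(Y) = c}` for a
matroid `M₁` of rank `s` on `E₁`) whose ratios `W c / C(s, c)` are non-decreasing in `c ≤ s` (true for every uniform
matroid `U_{s,k}`, `k ≥ s`), and for `m` free points, the row `(q, r−1)` of the truncation `T_r(M₁ ⊕ U_{m,m})` reduces,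
in the regime `r + q ≤ s + m` (every member's complement spans), to the inequality

  `r · Σ_c W c · C(m, q−c)  ≤  (q+1) · Σ_c W c · C(m, r−1−c)`        (`majorize`).

Proof: with `D c := (q+1)·C(m, r−1−c) − r·C(m, q−c)·[c ≤ q]`, (i) the BASE `Σ_c C(s,c)·D c = (q+1)·C(s+m, r−1) − r·C(s+m, q)`
is `≥ 0` (Vandermonde + the uniform LYM inequality at `s + m ≥ r + q`); (ii) `D c ≥ 0 ⟺ m + 2c ≥ r + q` for `c ≤ q`, so
every negative `D c` precedes every positive one; (iii) since `W c / C(s,c)` is non-decreasing, `Σ_c W c · D c ≥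
(W c₀ / C(s,c₀)) · Σ_c C(s,c) · D c ≥ 0` with `c₀` the last negative index (a majorization / Chebyshev step).

* `choose_tight`, `lym_base` — the uniform LYM inequality `r·C(n,q) ≤ (q+1)·C(n,r−1)` for `n ≥ r+q`;
* `choose_le_choose_of_le_half`, `choose_le_choose_of_add_le` — unimodality of binomials;
* `D_nonneg`, `D_nonpos` — the sign of `D c`;
* `sum_choose_mul_choose_range` — Vandermonde over `range`;
* `majorize` — the theorem.
No `def`, no `instance`, no notation.  Axioms: standard.
-/

namespace PercRepro

open Finset

namespace OneFlat

/-- `C(r+q, r−1) · (q+1) = r · C(r+q, q)` — the tight uniform LYM identity (`U_{r,r+q}`). -/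
theorem choose_tight {r q : ℕ} (hq : q + 1 ≤ r) :
    ((r + q).choose (r - 1) : ℚ) * (q + 1) = (r : ℚ) * ((r + q).choose q : ℚ) := by
  have h1 : (r + q).choose (r - 1) = (r + q).choose (q + 1) := by
    rw [← Nat.choose_symm (by omega)]
    congr 1
    omega
  have h2 := Nat.choose_succ_right_eq (r + q) q
  have h3 : r + q - q = r := by omega
  rw [h3] at h2
  rw [h1]
  exact_mod_cast (by rw [h2]; ring : (r + q).choose (q + 1) * (q + 1) = r * (r + q).choose q)

/-- The uniform LYM inequality: for `n ≥ r + q` and `q + 1 ≤ r`, `r · C(n, q) ≤ (q+1) · C(n, r−1)`. -/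
theorem lym_base {n r q : ℕ} (hq : q + 1 ≤ r) (hn : r + q ≤ n) :
    (r : ℚ) * (n.choose q : ℚ) ≤ ((q : ℚ) + 1) * (n.choose (r - 1) : ℚ) := by
  have hmono := PriceMono.choose_div_choose_mono (p := r) (p' := n - q) (q := q) (u := r - 1)
    (by omega) (by omega) (by omega)
  have hnq : n - q + q = n := by omega
  rw [hnq] at hmono
  have hpos1 : (0 : ℚ) < ((r + q).choose q : ℚ) := by exact_mod_cast Nat.choose_pos (by omega)
  have hpos2 : (0 : ℚ) < (n.choose q : ℚ) := by exact_mod_cast Nat.choose_pos (by omega)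
  rw [div_le_div_iff₀ hpos1 hpos2] at hmono
  have ht := choose_tight hq
  nlinarith [ht, hmono, hpos1, hpos2]

/-- Binomials increase on the left half: `x ≤ y ≤ n / 2 → C(n, x) ≤ C(n, y)`. -/
theorem choose_le_choose_of_le_half {n x y : ℕ} (hxy : x ≤ y) (hy : y ≤ n / 2) :
    n.choose x ≤ n.choose y := by
  induction y, hxy using Nat.le_induction with
  | base => exact le_rfl
  | succ y hxy ih =>
    exact (ih (by omega)).trans (Nat.choose_le_succ_of_lt_half_left (by omega))

/-- Unimodality: `a ≤ b` and `n ≤ a + b` give `C(n, b) ≤ C(n, a)`. -/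
theorem choose_le_choose_of_add_le {n a b : ℕ} (hab : a ≤ b) (hn : n ≤ a + b) :
    n.choose b ≤ n.choose a := by
  rcases Nat.lt_or_ge n b with hnb | hbn
  · rw [Nat.choose_eq_zero_of_lt hnb]; exact Nat.zero_le _
  · -- `b ≤ n`; `C(n,b) = C(n, n-b)` and `n - b ≤ a ≤ b`
    rw [← Nat.choose_symm hbn]
    rcases Nat.lt_or_ge a (n / 2 + 1) with ha | ha
    · exact choose_le_choose_of_le_half (by omega) (by omega)
    · -- `a > n/2`: then `C(n,a) = C(n, n-a)` with `n - b ≤ n - a ≤ n/2`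
      have han : a ≤ n := le_trans hab hbn
      rw [← Nat.choose_symm han]
      exact choose_le_choose_of_le_half (by omega) (by omega)

/-- The sign lemma, positive side: for `c ≤ q`, `q + 1 ≤ r` and `r + q ≤ m + 2c`,
`r · C(m, q−c) ≤ (q+1) · C(m, r−1−c)`. -/
theorem D_nonneg {m r q c : ℕ} (hq : q + 1 ≤ r) (hc : c ≤ q) (hm : r + q ≤ m + 2 * c) :
    (r : ℚ) * (m.choose (q - c) : ℚ) ≤ ((q : ℚ) + 1) * (m.choose (r - 1 - c) : ℚ) := by
  have h := lym_base (n := m) (r := r - c) (q := q - c) (by omega) (by omega)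
  have e1 : r - c - 1 = r - 1 - c := by omega
  rw [e1] at h
  have hcast1 : ((r - c : ℕ) : ℚ) = (r : ℚ) - c := by push_cast [Nat.cast_sub (by omega : c ≤ r)]; ring
  have hcast2 : ((q - c : ℕ) : ℚ) = (q : ℚ) - c := by push_cast [Nat.cast_sub hc]; ring
  rw [hcast1, hcast2] at h
  have hA : (0 : ℚ) ≤ (m.choose (q - c) : ℚ) := by positivity
  have hS : (0 : ℚ) ≤ (m.choose (r - 1 - c) : ℚ) := by positivity
  have hr : ((q : ℚ) + 1) ≤ r := by exact_mod_cast hq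
  have hcq : (c : ℚ) ≤ q := by exact_mod_cast hc
  -- `r (q-c+1) ≤ (q+1)(r-c)` since `r ≥ q+1`; multiply `h` through
  nlinarith [h, hA, hS, hr, hcq, mul_nonneg hA (sub_nonneg.2 hr), mul_nonneg hS (by linarith : (0:ℚ) ≤ (q:ℚ) - c + 1)]

/-- The sign lemma, negative side: for `c ≤ q`, `q + 1 ≤ r` and `m + 2c < r + q`,
`(q+1) · C(m, r−1−c) ≤ r · C(m, q−c)`. -/
theorem D_nonpos {m r q c : ℕ} (hq : q + 1 ≤ r) (hc : c ≤ q) (hm : m + 2 * c < r + q) :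
    ((q : ℚ) + 1) * (m.choose (r - 1 - c) : ℚ) ≤ (r : ℚ) * (m.choose (q - c) : ℚ) := by
  have h := choose_le_choose_of_add_le (n := m) (a := q - c) (b := r - 1 - c) (by omega) (by omega)
  have h' : (m.choose (r - 1 - c) : ℚ) ≤ (m.choose (q - c) : ℚ) := by exact_mod_cast h
  have hr : ((q : ℚ) + 1) ≤ r := by exact_mod_cast hq
  have hS : (0 : ℚ) ≤ (m.choose (r - 1 - c) : ℚ) := by positivity
  nlinarith [h', hr, hS]

/-- Vandermonde over `range`: `Σ_{c < n+1} C(s,c) · C(m, n−c) = C(s+m, n)`. -/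
theorem sum_choose_mul_choose_range (s m n : ℕ) :
    ∑ c ∈ range (n + 1), (s.choose c : ℚ) * (m.choose (n - c) : ℚ) = ((s + m).choose n : ℚ) := by
  have h := Nat.add_choose_eq s m n
  rw [Finset.Nat.sum_antidiagonal_eq_sum_range_succ (fun i j => s.choose i * m.choose j) n] at h
  exact_mod_cast h.symm

/-- The ordering: a negative `D c'` precedes a positive `D c`. -/
theorem lt_of_D_neg_of_D_pos {m r q c c' : ℕ} (hq : q + 1 ≤ r)
    (hneg : ((q : ℚ) + 1) * (m.choose (r - 1 - c') : ℚ)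
      - (r : ℚ) * (if c' ≤ q then (m.choose (q - c') : ℚ) else 0) < 0)
    (hpos : 0 < ((q : ℚ) + 1) * (m.choose (r - 1 - c) : ℚ)
      - (r : ℚ) * (if c ≤ q then (m.choose (q - c) : ℚ) else 0)) :
    c' < c := by
  have hS' : (0 : ℚ) ≤ ((q : ℚ) + 1) * (m.choose (r - 1 - c') : ℚ) := by positivity
  -- `c' ≤ q`, else the subtracted term vanishes
  have hc' : c' ≤ q := by
    by_contra hcon
    rw [if_neg hcon] at hneg
    linarith
  rw [if_pos hc'] at hneg
  -- `m + 2c' < r + q`, else `D_nonneg` contradicts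
  have hm' : m + 2 * c' < r + q := by
    by_contra hcon
    have := D_nonneg (m := m) (r := r) (q := q) (c := c') hq hc' (by omega)
    linarith
  by_contra hcc
  push Not at hcc
  -- `c ≤ c' ≤ q` and `m + 2c ≤ m + 2c' < r + q`: `D c ≤ 0`
  have hc : c ≤ q := le_trans hcc hc'
  rw [if_pos hc] at hpos
  have := D_nonpos (m := m) (r := r) (q := q) (c := c) hq hc (by omega)
  linarith

/-- **THE MAJORIZATION THEOREM.** For a profile `W` vanishing above `s` with `W c / C(s,c)` non-decreasing on
`c ≤ s` (cross-multiplied: `W c' · C(s,c) ≤ W c · C(s,c')` for `c' ≤ c ≤ s`), `q + 2 ≤ r` and `r + q ≤ s + m`: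
`r · Σ_{c ≤ q} W c · C(m, q−c) ≤ (q+1) · Σ_{c < r} W c · C(m, r−1−c)`. -/
theorem majorize (W : ℕ → ℕ) (s m r q : ℕ) (hq : q + 2 ≤ r) (hreg : r + q ≤ s + m)
    (hW : ∀ c, s < c → W c = 0)
    (hmono : ∀ c' c, c' ≤ c → c ≤ s → W c' * s.choose c ≤ W c * s.choose c') :
    (r : ℚ) * ∑ c ∈ range (q + 1), (W c : ℚ) * (m.choose (q - c) : ℚ) ≤
      ((q : ℚ) + 1) * ∑ c ∈ range r, (W c : ℚ) * (m.choose (r - 1 - c) : ℚ) := by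
  -- the summand `D c`
  set D : ℕ → ℚ := fun c =>
    ((q : ℚ) + 1) * (m.choose (r - 1 - c) : ℚ) - (r : ℚ) * (if c ≤ q then (m.choose (q - c) : ℚ) else 0)
    with hD
  -- (0) the member sum over `range (q+1)` is the guarded sum over `range r`
  have hfilter : (range r).filter (fun c => c ≤ q) = range (q + 1) := by
    ext c; simp only [mem_filter, mem_range]; omega
  have hmem : ∀ (V : ℕ → ℚ), ∑ c ∈ range (q + 1), V c * (m.choose (q - c) : ℚ) =
      ∑ c ∈ range r, V c * (if c ≤ q then (m.choose (q - c) : ℚ) else 0) := by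
    intro V
    rw [← hfilter, sum_filter]
    apply sum_congr rfl
    intro c _
    split_ifs <;> simp
  -- (1) the goal is `0 ≤ Σ W c · D c`
  have hgoal : ((q : ℚ) + 1) * ∑ c ∈ range r, (W c : ℚ) * (m.choose (r - 1 - c) : ℚ)
      - (r : ℚ) * ∑ c ∈ range (q + 1), (W c : ℚ) * (m.choose (q - c) : ℚ)
      = ∑ c ∈ range r, (W c : ℚ) * D c := by
    rw [hmem, mul_sum, mul_sum, ← sum_sub_distrib]
    apply sum_congr rfl
    intro c _
    simp only [hD]
    ring
  suffices hsum : 0 ≤ ∑ c ∈ range r, (W c : ℚ) * D c by linarith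
  -- (2) the base: `Σ C(s,c) · D c = (q+1) C(s+m, r-1) - r C(s+m, q) ≥ 0`
  have hbase : 0 ≤ ∑ c ∈ range r, (s.choose c : ℚ) * D c := by
    have h1 : ∑ c ∈ range r, (s.choose c : ℚ) * D c
        = ((q : ℚ) + 1) * ∑ c ∈ range r, (s.choose c : ℚ) * (m.choose (r - 1 - c) : ℚ)
          - (r : ℚ) * ∑ c ∈ range (q + 1), (s.choose c : ℚ) * (m.choose (q - c) : ℚ) := by
      rw [hmem, mul_sum, mul_sum, ← sum_sub_distrib]
      apply sum_congr rfl
      intro c _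
      simp only [hD]
      ring
    have h2 : ∑ c ∈ range r, (s.choose c : ℚ) * (m.choose (r - 1 - c) : ℚ) = ((s + m).choose (r - 1) : ℚ) := by
      have := sum_choose_mul_choose_range s m (r - 1)
      rwa [show r - 1 + 1 = r by omega] at this
    rw [h1, h2, sum_choose_mul_choose_range s m q]
    have := lym_base (n := s + m) (r := r) (q := q) (by omega) hreg
    linarith
  -- (3) majorization
  by_cases hneg : ∃ c ∈ range r, D c < 0
  · obtain ⟨c₁, hc₁r, hc₁⟩ := hneg
    set N : Finset ℕ := (range r).filter (fun c => D c < 0) with hN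
    have hNne : N.Nonempty := ⟨c₁, by simp only [hN, mem_filter]; exact ⟨hc₁r, hc₁⟩⟩
    set cN := N.max' hNne with hcN
    have hcN_mem : cN ∈ N := N.max'_mem hNne
    have hcN_neg : D cN < 0 := by
      have := hcN_mem; simp only [hN, mem_filter] at this; exact this.2
    have hle_cN : ∀ c ∈ range r, D c < 0 → c ≤ cN := by
      intro c hc hDc
      exact N.le_max' c (by simp only [hN, mem_filter]; exact ⟨hc, hDc⟩)
    set c₀ := min cN s with hc₀
    have hc₀s : c₀ ≤ s := min_le_right _ _
    have hc₀pos : (0 : ℚ) < (s.choose c₀ : ℚ) := by exact_mod_cast Nat.choose_pos hc₀s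
    -- the pointwise comparison
    have hpt : ∀ c ∈ range r, (W c₀ : ℚ) * (s.choose c : ℚ) * D c ≤ (W c : ℚ) * (s.choose c₀ : ℚ) * D c := by
      intro c hc
      rcases lt_trichotomy (D c) 0 with hDc | hDc | hDc
      · -- negative: `c ≤ cN`
        have hccN : c ≤ cN := hle_cN c hc hDc
        rcases Nat.lt_or_ge s c with hsc | hcs
        · rw [hW c hsc, Nat.choose_eq_zero_of_lt hsc]; simp
        · have hcc₀ : c ≤ c₀ := le_min hccN hcs
          have hm := hmono c c₀ hcc₀ hc₀s
          have hm' : (W c : ℚ) * (s.choose c₀ : ℚ) ≤ (W c₀ : ℚ) * (s.choose c : ℚ) := by exact_mod_cast hm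
          nlinarith [hm', hDc]
      · rw [hDc]; simp
      · -- positive: `cN < c`
        have hcNc : cN < c := lt_of_D_neg_of_D_pos (by omega) hcN_neg hDc
        rcases Nat.lt_or_ge s c with hsc | hcs
        · rw [hW c hsc, Nat.choose_eq_zero_of_lt hsc]; simp
        · have hc₀c : c₀ ≤ c := le_trans (min_le_left _ _) hcNc.le
          have hm := hmono c₀ c hc₀c hcs
          have hm' : (W c₀ : ℚ) * (s.choose c : ℚ) ≤ (W c : ℚ) * (s.choose c₀ : ℚ) := by exact_mod_cast hm
          nlinarith [hm', hDc]
    have hsumle := sum_le_sum hpt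
    have hL : ∑ c ∈ range r, (W c₀ : ℚ) * (s.choose c : ℚ) * D c
        = (W c₀ : ℚ) * ∑ c ∈ range r, (s.choose c : ℚ) * D c := by
      rw [mul_sum]; apply sum_congr rfl; intro c _; ring
    have hR : ∑ c ∈ range r, (W c : ℚ) * (s.choose c₀ : ℚ) * D c
        = (s.choose c₀ : ℚ) * ∑ c ∈ range r, (W c : ℚ) * D c := by
      rw [mul_sum]; apply sum_congr rfl; intro c _; ring
    rw [hL, hR] at hsumle
    have hW₀ : (0 : ℚ) ≤ (W c₀ : ℚ) := by positivity
    have hLnn : (0 : ℚ) ≤ (W c₀ : ℚ) * ∑ c ∈ range r, (s.choose c : ℚ) * D c := mul_nonneg hW₀ hbase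
    exact (mul_nonneg_iff_of_pos_left hc₀pos).1 (le_trans hLnn hsumle)
  · push Not at hneg
    apply sum_nonneg
    intro c hc
    exact mul_nonneg (by positivity) (hneg c hc)

end OneFlat

end PercRepro
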